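import Summits.QuantumFields.YangMills.Theorems.BalabanUVNodesN15KingModelFreeRGForms
import HarnessLib

/-!
# BalabanUVNodes ∕ N15 — THE KING-MODEL RUNG, FREE-FIELD EDITION (PART Τ-c₁): THE DIAGONAL OF THE INVERSE FROM THE PLANE-WAVE FORM —
# `⟨e_y, Δ⁻¹e_y⟩ ≤ |Ω|⁻¹ Σ_q Δ̂(q)⁻¹` for any symmetric coercive operator on the torus `Π ℤ∕M_μ` whose quadratic form is diagonal in plane waves
# (King's (4.35)), by the variational characterisation of `Δ⁻¹` and Fourier inversion — no inverse kernel is computed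
# (Track A, DAG node N15 = NE2; FAN-OUT v1.1 §N15 s3 «KING-MODEL RUNG»; regen R453 (b))

HONEST FRAMING.  Count-neutral (cell `pub-ymgap`, seat `pub-ymgap-dag-n15-e` g19; `--supports stmt-QuantumFields-27366 --as helper` = K3⁸
`SpineGivenEndpointR13SepCoPHV`).  LINEAR ALGEBRA on the finite torus in the vocabulary of the typer's `King1986/TorusBlockForm` (`ft`, `chi`,
`inversion`, `parseval_dot`); no Bałaban object, no record key.  WHY: [King1986] Theorem 3.1 (3.4) for the free field (part Τ-g) needs, site by site, the
variance `G_k(y,y) = (Δ^{(k)})⁻¹(y,y)` of the unit-lattice field under the Gaussian `e^{−S^{(k),1}}` — the letter `⟨e_i, Δ⁻¹e_i⟩ ≤ G` of part Τ-b's Chernoff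
bound; King takes such bounds from the Fourier representation (p. 674, (4.35): *"So Δ^{(k)} has the representation ⟨φ, Δ^{(k)}φ⟩ = |Ω|^{−1}Σ_{p′}
|φ̃(p′)|²Δ^{(k)}(p′)"*).  THIS FILE: §1 the variational identity `⟨J, Δ⁻¹J⟩ = 2⟨J, x*⟩ − ⟨x*, Δx*⟩` (`x* = Δ⁻¹J`) hence `⟨J, Δ⁻¹J⟩ ≤ B` whenever
`2⟨J,x⟩ − ⟨x,Δx⟩ ≤ B` for all `x`; §2 on the torus, `|Ω|·x(y) ≤ Σ_p |x̃(p)|` (inversion, `|e^{ip·y}| = 1`) and `2u − Du² ≤ D⁻¹` give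
★ `green_single_le`: `⟨e_y, Δ⁻¹e_y⟩ ≤ |Ω|⁻¹Σ_q D(q)⁻¹` for every operator with `|Ω|⟨x,Δx⟩ = Σ_q D(q)|x̃(q)|²`, `D > 0`; part Τ-c₂ evaluates the
momentum sum for King's `Δ^{(k)}` on the cubic torus.  NOT a node discharge; nothing continuum-YM ∕ ℝ⁴ ∕ OS ∕ mass-gap ∕ Clay.  0 `sorry`, 0 `def`;
standard axioms.
Locators: [King1986] (4.35) p.674; (3.4) p.655.
-/

noncomputable section

namespace Summit.QuantumFields.YangMills.BalabanUVNodes.N15KingModelRung.FreeField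

open Real Finset Matrix
open scoped ComplexConjugate
open Literature.MathematicalPhysics.QuantumFieldTheory.Balaban1983to89.B5Prop11Plancherel (Tor chi)
open Literature.MathematicalPhysics.QuantumFieldTheory.Balaban1983to89.QGQInverse (Coercive isUnit_of_coercive)
open Literature.LinearAlgebra.Matrix (dotProduct_self_nonneg_real)
open Literature.MathematicalPhysics.QuantumFieldTheory.King1986.Torus (ft inversion parseval_dot)

/-! ## §1 The variational characterisation of the inverse form (any finite index set) -/

section Variational

variable {n : Type*} [Fintype n] [DecidableEq n]

/-- For symmetric invertible `Δ` and `x* = Δ⁻¹J`: `Δx* = J` and `⟨x*, Δx*⟩ = ⟨J, Δ⁻¹J⟩`. [folklore] -/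
theorem inv_quad_letters {Δ : Matrix n n ℝ} (hunit : IsUnit Δ) (J : n → ℝ) :
    Δ *ᵥ (Δ⁻¹ *ᵥ J) = J ∧ (Δ⁻¹ *ᵥ J) ⬝ᵥ (Δ *ᵥ (Δ⁻¹ *ᵥ J)) = J ⬝ᵥ (Δ⁻¹ *ᵥ J) := by
  have hdet : IsUnit Δ.det := (Matrix.isUnit_iff_isUnit_det Δ).mp hunit
  have h1 : Δ *ᵥ (Δ⁻¹ *ᵥ J) = J := by rw [Matrix.mulVec_mulVec, Matrix.mul_nonsing_inv Δ hdet, Matrix.one_mulVec]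
  refine ⟨h1, ?_⟩
  rw [h1, dotProduct_comm]

/-- **The variational bound**: if `2⟨J, x⟩ − ⟨x, Δx⟩ ≤ B` for every `x`, then `⟨J, Δ⁻¹J⟩ ≤ B` (symmetric invertible `Δ`; test at `x* = Δ⁻¹J`).
[folklore] -/
theorem inv_quad_le_of_forall {Δ : Matrix n n ℝ} (hunit : IsUnit Δ) (J : n → ℝ) {B : ℝ} (h : ∀ x : n → ℝ, 2 * (J ⬝ᵥ x) - x ⬝ᵥ (Δ *ᵥ x) ≤ B) :
    J ⬝ᵥ (Δ⁻¹ *ᵥ J) ≤ B := by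
  obtain ⟨_, h2⟩ := inv_quad_letters hunit J
  have h3 := h (Δ⁻¹ *ᵥ J)
  rw [h2] at h3
  linarith

end Variational

/-! ## §2 On the torus: the plane-wave form controls the diagonal of the inverse -/

section TorusGreen

variable {d : ℕ} (M : Fin d → ℕ) [∀ μ, NeZero (M μ)]

/-- `|e^{ip·x}| = 1`. [folklore] -/
theorem norm_chi (p x : Tor M) : ‖chi M p x‖ = 1 := by
  unfold chi
  rw [norm_prod]
  refine Finset.prod_eq_one fun μ _ => ?_
  rw [ZMod.stdAddChar_apply]
  exact Circle.norm_coe _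

/-- **Fourier inversion bounds a value by the `ℓ¹` norm of the transform**: `|Ω|·x(y) ≤ Σ_p |x̃(p)|`. [folklore] -/
theorem card_mul_apply_le (x : Tor M → ℝ) (y : Tor M) : (Fintype.card (Tor M) : ℝ) * x y ≤ ∑ p : Tor M, ‖ft M x p‖ := by
  have hinv := inversion M x y
  have h1 : ‖∑ p : Tor M, ft M x p * chi M p y‖ = (Fintype.card (Tor M) : ℝ) * |x y| := by
    rw [hinv, norm_mul, Complex.norm_natCast, Complex.norm_real, Real.norm_eq_abs]
  have h2 : ‖∑ p : Tor M, ft M x p * chi M p y‖ ≤ ∑ p : Tor M, ‖ft M x p‖ := by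
    refine (norm_sum_le _ _).trans (Finset.sum_le_sum fun p _ => ?_)
    rw [norm_mul, norm_chi, mul_one]
  have h3 : x y ≤ |x y| := le_abs_self _
  have hc : (0 : ℝ) ≤ Fintype.card (Tor M) := Nat.cast_nonneg _
  calc (Fintype.card (Tor M) : ℝ) * x y ≤ (Fintype.card (Tor M) : ℝ) * |x y| := mul_le_mul_of_nonneg_left h3 hc
    _ = ‖∑ p : Tor M, ft M x p * chi M p y‖ := h1.symm
    _ ≤ _ := h2

/-- The per-mode optimisation letter `2u − Du² ≤ D⁻¹` (`D > 0`). [folklore] -/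
theorem two_mul_sub_sq_le {u D : ℝ} (hD : 0 < D) : 2 * u - D * u ^ 2 ≤ D⁻¹ := by
  have h : 0 ≤ D * (u - D⁻¹) ^ 2 := by positivity
  have e : D * (u - D⁻¹) ^ 2 = D * u ^ 2 - 2 * u + D⁻¹ := by field_simp; ring
  linarith [h, e]

/-- **The test bound**: if `|Ω|⟨x, Δx⟩ = Σ_q D(q)|x̃(q)|²` with `D > 0`, then for every `x` and site `y`,
`|Ω|·(2x(y) − ⟨x, Δx⟩) ≤ Σ_q D(q)⁻¹`. [cite: King1986, (4.35) p.674] -/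
theorem card_mul_test_le {Δ : Matrix (Tor M) (Tor M) ℝ} {D : Tor M → ℝ}
    (hform : ∀ x : Tor M → ℝ, (Fintype.card (Tor M) : ℝ) * (x ⬝ᵥ (Δ *ᵥ x)) = ∑ q, D q * ‖ft M x q‖ ^ 2) (hD : ∀ q, 0 < D q)
    (x : Tor M → ℝ) (y : Tor M) :
    (Fintype.card (Tor M) : ℝ) * (2 * x y - x ⬝ᵥ (Δ *ᵥ x)) ≤ ∑ q, (D q)⁻¹ := by
  have h1 := card_mul_apply_le M x y
  rw [mul_sub, hform x]
  calc (Fintype.card (Tor M) : ℝ) * (2 * x y) - ∑ q, D q * ‖ft M x q‖ ^ 2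
      ≤ 2 * ∑ q, ‖ft M x q‖ - ∑ q, D q * ‖ft M x q‖ ^ 2 := by linarith
    _ = ∑ q, (2 * ‖ft M x q‖ - D q * ‖ft M x q‖ ^ 2) := by rw [Finset.mul_sum, ← Finset.sum_sub_distrib]
    _ ≤ ∑ q, (D q)⁻¹ := Finset.sum_le_sum fun q _ => two_mul_sub_sq_le (hD q)

/-- ★ **THE DIAGONAL OF THE INVERSE FROM THE PLANE-WAVE FORM**: for a symmetric coercive operator `Δ` on the torus `Π ℤ∕M_μ` with
`|Ω|⟨x, Δx⟩ = Σ_q D(q)|x̃(q)|²` (`D > 0`), every site `y` has `⟨e_y, Δ⁻¹e_y⟩ ≤ |Ω|⁻¹·Σ_q D(q)⁻¹` — the variance of the Gaussian field at `y` is at most the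
momentum average of the inverse symbol. [cite: King1986, (4.35) p.674] -/
theorem green_single_le {Δ : Matrix (Tor M) (Tor M) ℝ} {δ : ℝ} (hδ : 0 < δ) (hΔ : Coercive Δ δ) {D : Tor M → ℝ}
    (hform : ∀ x : Tor M → ℝ, (Fintype.card (Tor M) : ℝ) * (x ⬝ᵥ (Δ *ᵥ x)) = ∑ q, D q * ‖ft M x q‖ ^ 2) (hD : ∀ q, 0 < D q) (y : Tor M) :
    Pi.single y (1 : ℝ) ⬝ᵥ (Δ⁻¹ *ᵥ Pi.single y 1) ≤ (Fintype.card (Tor M) : ℝ)⁻¹ * ∑ q, (D q)⁻¹ := by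
  have hunit : IsUnit Δ := isUnit_of_coercive hδ hΔ
  have hc : (0 : ℝ) < Fintype.card (Tor M) := by exact_mod_cast Fintype.card_pos
  refine inv_quad_le_of_forall hunit _ fun x => ?_
  rw [single_dotProduct, one_mul]
  have h := card_mul_test_le M hform hD x y
  rw [← mul_le_mul_iff_of_pos_left hc, ← mul_assoc, mul_inv_cancel₀ hc.ne', one_mul]
  exact h

end TorusGreen

end Summit.QuantumFields.YangMills.BalabanUVNodes.N15KingModelRung.FreeField

end
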